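import Literature.Analysis.FluidPDE.TaoCascadeODE
import Mathlib.Analysis.Calculus.Deriv.Add
import Mathlib.Analysis.SpecialFunctions.Sqrt
import Mathlib.Tactic.FinCases
import Mathlib.Tactic.LinearCombination
import HarnessLib

/-!
# Tao's cascade ODE: Theorem 6.2 implies Theorem 4.2 (the structure constants of §6.1)

T. Tao, *Finite time blowup for an averaged three-dimensional Navier–Stokes equation*,
J. Amer. Math. Soc. **29** (2016), 601–674 = arXiv:1402.0290v3 (held as `paper:arxiv-1402.0290`;
equation numbers below are those of that text: (4.2), (4.3), (4.10)–(4.13), Table 1 on p. 31,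
(6.1)–(6.10); the companion file `TaoCascadeODE.lean` cites the same displays with a shifted
count, its "(4.5)–(4.11)" = (4.6)–(4.13) and "(6.0)–(6.8)" = (6.1)–(6.10), "Table 2" = Table 1),
§6.1, p. 31: the choice `m = 4`, the structure constants of **Table 1**, and the passage from the
conclusions of Lemma 4.1 to the model system of §6.1, by which "to prove Theorem 4.2, it thus
suffices to show Theorem 6.2".

Built on the accepted `Literature/Analysis/FluidPDE/TaoCascadeODE.lean`
(`TaoCascade.CascadeODESolution`, `TaoCascade.odeBlowup` = Thm 4.2, `TaoCascade.TaoODESystem`,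
`TaoCascade.noGlobalODESolution` = Thm 6.2), whose module docstring lists "the proof of Thm. 4.2
from Thm. 6.2 (§6.1, a finite computation with Table 2)" as not yet in the tree. Everything in
this file is **proved**:

* `taoCoeff` — Table 1 as structure constants `Fin 4 → Fin 4 → Fin 4 → ℤ × ℤ × ℤ → ℝ`
  (`0`-based modes: Tao's mode `i` is the index `i - 1`), the same-scale rows collected in
  `tableZero`;
* `taoCoeff_symmetric`, `taoCoeff_cancelling` — Table 1 obeys the symmetry condition (4.2) and
  the cancellation condition (4.3) ("It is clear that the required symmetry property (4.2) and the
  cancellation property (4.3) hold", p. 31);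
* `quadTerm_taoCoeff_zero` … `quadTerm_taoCoeff_three` — with these constants the main term of the
  equation of motion (4.10) is literally the main term of (6.3)–(6.6);
  `sum_quadTerm_mul_taoCoeff` — summing the energy inequality (4.11) over the four modes gives the
  right side of (6.7) (all same-scale cubic terms cancel);
* `CascadeODESolution.toTaoODESystem` — the conclusions of Lemma 4.1 for Table 1 (datum mode
  `i₀ = 0`, implied constants `K₁ ≥ 0`, `K₂`) give the system of §6.1 for the combined energies
  `E_n = ∑ᵢ E_{i,n}` with the same implied constants;
* `odeBlowup_of_noGlobalODESolution` — **Theorem 6.2 ⇒ Theorem 4.2**.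

## A correction to Table 1

Two entries of the printed table are misprints: it lists `α_{3,1,1,(0,0,0)} = -ε² exp(-K^{-10})/2`
and `α_{1,1,3,(0,0,0)} = ε² exp(K^{-10})`, next to `α_{1,3,1,(0,0,0)} = -ε² exp(-K^{10})/2`. As
printed, the symmetry (4.2) (`α_{3,1,1} = α_{1,3,1}`) and the cancellation (4.3) for the index
triple `{1,1,3}` (`2α_{1,1,3} + 2α_{1,3,1} + 2α_{3,1,1} = 0`) both fail, and (4.10) would not
reproduce the coefficients `ε² exp(-K^{10})` of (6.3) and (6.5), which are the equations the table
is introduced to produce and the only ones used afterwards. With `exp(-K^{10})` in all three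
entries — the reading adopted in `tableZero` — (4.2), (4.3) and (6.3)–(6.7) hold exactly, as the
proofs below certify. The named facts `TaoCascade.odeBlowup`, `TaoCascade.noGlobalODESolution` do
not involve the table; only this proved bridge does.

## References

* T. Tao, J. Amer. Math. Soc. 29 (2016), 601–674, arXiv:1402.0290v3, §4 ((4.2), (4.3),
  (4.10)–(4.13), Thm 4.2), §6.1 (Table 1, (6.1)–(6.10), Thm 6.2). Key `Tao2016AveragedNS`.
-/

noncomputable section

open Set MeasureTheory intervalIntegral

namespace Literature.Analysis.FluidPDE

namespace TaoCascade

/-! ### Finite combinatorics of the shift set -/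

/-- The sum over the shift set `S` written out. [folklore] -/
theorem sum_shiftSet {M : Type*} [AddCommMonoid M] (f : ℤ × ℤ × ℤ → M) :
    ∑ μ ∈ shiftSet, f μ = f (0, 0, 0) + f (1, 0, 0) + f (0, 1, 0) + f (0, 0, 1) := by
  rw [shiftSet, Finset.sum_insert (by decide), Finset.sum_insert (by decide),
    Finset.sum_insert (by decide), Finset.sum_singleton]
  abel

/-! ### Table 1: Tao's structure constants for `m = 4` -/

/-- The same-scale rows (`μ = (0,0,0)`) of **Table 1** (Tao 2016, p. 31), as a function of the
`0`-based mode indices `(a, b, c) = (i₁ - 1, i₂ - 1, i₃ - 1)`: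
`α_{3,4,1} = α_{4,3,1} = -ε⁻²/2`, `α_{1,3,4} = α_{3,1,4} = ε⁻²/2`, `α_{1,2,1} = α_{2,1,1} = -ε/2`,
`α_{1,1,2} = ε`, `α_{1,3,1} = α_{3,1,1} = -ε² e^{-K^{10}}/2`, `α_{1,1,3} = ε² e^{-K^{10}}`,
`α_{3,3,2} = -ε⁻¹K^{10}`, `α_{2,3,3} = α_{3,2,3} = ε⁻¹K^{10}/2`, all other entries `0`; the two
misprinted entries `α_{3,1,1}`, `α_{1,1,3}` are read with `exp(-K^{10})` (module docstring). [cite: Tao2016AveragedNS, §6.1 Table 1] -/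
def tableZero (K ε : ℝ) : Fin 4 → Fin 4 → Fin 4 → ℝ :=
  ![![![0, ε, ε ^ 2 * Real.exp (-K ^ 10), 0], ![-ε / 2, 0, 0, 0],
      ![-(ε ^ 2 * Real.exp (-K ^ 10)) / 2, 0, 0, (ε ^ 2)⁻¹ / 2], ![0, 0, 0, 0]],
    ![![-ε / 2, 0, 0, 0], ![0, 0, 0, 0], ![0, 0, ε⁻¹ * K ^ 10 / 2, 0], ![0, 0, 0, 0]],
    ![![-(ε ^ 2 * Real.exp (-K ^ 10)) / 2, 0, 0, (ε ^ 2)⁻¹ / 2], ![0, 0, ε⁻¹ * K ^ 10 / 2, 0],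
      ![0, -(ε⁻¹ * K ^ 10), 0, 0], ![-(ε ^ 2)⁻¹ / 2, 0, 0, 0]],
    ![![0, 0, 0, 0], ![0, 0, 0, 0], ![-(ε ^ 2)⁻¹ / 2, 0, 0, 0], ![0, 0, 0, 0]]]

/-- **Table 1** (Tao 2016, p. 31) as structure constants for `m = 4` (`0`-based modes; zero off
the table, in particular zero off `S`): the same-scale rows `tableZero` and the three
scale-coupling rows `α_{4,4,1,(0,0,1)} = (1+ε₀)^{5/2} K`,
`α_{1,4,4,(1,0,0)} = α_{4,1,4,(0,1,0)} = -(1+ε₀)^{5/2} K/2`. [cite: Tao2016AveragedNS, §6.1 Table 1] -/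
def taoCoeff (ε₀ K ε : ℝ) (a b c : Fin 4) (μ : ℤ × ℤ × ℤ) : ℝ :=
  if μ = (0, 0, 0) then tableZero K ε a b c
  else if μ = (0, 0, 1) then (if a = 3 ∧ b = 3 ∧ c = 0 then (1 + ε₀) ^ ((5 : ℝ) / 2) * K else 0)
  else if μ = (1, 0, 0) then
    (if a = 0 ∧ b = 3 ∧ c = 3 then -((1 + ε₀) ^ ((5 : ℝ) / 2) * K) / 2 else 0)
  else if μ = (0, 1, 0) then
    (if a = 3 ∧ b = 0 ∧ c = 3 then -((1 + ε₀) ^ ((5 : ℝ) / 2) * K) / 2 else 0)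
  else 0

/-- Table 1 on the shift `(0,0,0)`. [cite: Tao2016AveragedNS, §6.1 Table 1] -/
theorem taoCoeff_shift0 (ε₀ K ε : ℝ) (a b c : Fin 4) :
    taoCoeff ε₀ K ε a b c (0, 0, 0) = tableZero K ε a b c := by
  rw [taoCoeff, if_pos rfl]

/-- Table 1 on the shift `(0,0,1)`. [cite: Tao2016AveragedNS, §6.1 Table 1] -/
theorem taoCoeff_shift3 (ε₀ K ε : ℝ) (a b c : Fin 4) :
    taoCoeff ε₀ K ε a b c (0, 0, 1) =
      if a = 3 ∧ b = 3 ∧ c = 0 then (1 + ε₀) ^ ((5 : ℝ) / 2) * K else 0 := by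
  rw [taoCoeff, if_neg (by decide), if_pos rfl]

/-- Table 1 on the shift `(1,0,0)`. [cite: Tao2016AveragedNS, §6.1 Table 1] -/
theorem taoCoeff_shift1 (ε₀ K ε : ℝ) (a b c : Fin 4) :
    taoCoeff ε₀ K ε a b c (1, 0, 0) =
      if a = 0 ∧ b = 3 ∧ c = 3 then -((1 + ε₀) ^ ((5 : ℝ) / 2) * K) / 2 else 0 := by
  rw [taoCoeff, if_neg (by decide), if_neg (by decide), if_pos rfl]

/-- Table 1 on the shift `(0,1,0)`. [cite: Tao2016AveragedNS, §6.1 Table 1] -/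
theorem taoCoeff_shift2 (ε₀ K ε : ℝ) (a b c : Fin 4) :
    taoCoeff ε₀ K ε a b c (0, 1, 0) =
      if a = 3 ∧ b = 0 ∧ c = 3 then -((1 + ε₀) ^ ((5 : ℝ) / 2) * K) / 2 else 0 := by
  rw [taoCoeff, if_neg (by decide), if_neg (by decide), if_neg (by decide), if_pos rfl]

/-- The same-scale table is symmetric in its first two indices ((4.2) for `μ = 0`). [cite: Tao2016AveragedNS, (4.2)] -/
theorem tableZero_symm (K ε : ℝ) (a b c : Fin 4) :
    tableZero K ε b a c = tableZero K ε a b c := by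
  fin_cases a <;> fin_cases b <;> fin_cases c <;> simp [tableZero]

/-- The same-scale table satisfies the cyclic cancellation ((4.3) for `μ = 0`): the sum over
the six permutations of the indices vanishes. [cite: Tao2016AveragedNS, (4.3)] -/
theorem tableZero_cancel (K ε : ℝ) (a b c : Fin 4) :
    tableZero K ε a b c + tableZero K ε a c b + tableZero K ε b a c + tableZero K ε b c a +
      tableZero K ε c a b + tableZero K ε c b a = 0 := by
  fin_cases a <;> fin_cases b <;> fin_cases c <;> simp [tableZero] <;> ring

/-- **Table 1 obeys the symmetry condition (4.2).** [cite: Tao2016AveragedNS, §6.1] -/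
theorem taoCoeff_symmetric (ε₀ K ε : ℝ) : IsSymmetricCoeff (taoCoeff ε₀ K ε) := by
  intro a b c μ₁ μ₂ μ₃ hμ
  simp only [mem_shiftSet_iff, Prod.mk.injEq] at hμ
  rcases hμ with ⟨rfl, rfl, rfl⟩ | ⟨rfl, rfl, rfl⟩ | ⟨rfl, rfl, rfl⟩ | ⟨rfl, rfl, rfl⟩
  · rw [taoCoeff_shift0, taoCoeff_shift0, tableZero_symm]
  · rw [taoCoeff_shift1, taoCoeff_shift2]
    split_ifs <;> tauto
  · rw [taoCoeff_shift2, taoCoeff_shift1]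
    split_ifs <;> tauto
  · rw [taoCoeff_shift3, taoCoeff_shift3]
    split_ifs <;> tauto

/-- **Table 1 obeys the cancellation condition (4.3).** [cite: Tao2016AveragedNS, §6.1] -/
theorem taoCoeff_cancelling (ε₀ K ε : ℝ) : IsCancellingCoeff (taoCoeff ε₀ K ε) := by
  intro a b c μ₁ μ₂ μ₃ hμ
  simp only [mem_shiftSet_iff, Prod.mk.injEq] at hμ
  rcases hμ with ⟨rfl, rfl, rfl⟩ | ⟨rfl, rfl, rfl⟩ | ⟨rfl, rfl, rfl⟩ | ⟨rfl, rfl, rfl⟩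
  · simp only [taoCoeff_shift0]
    exact tableZero_cancel K ε a b c
  · simp only [taoCoeff_shift1, taoCoeff_shift2, taoCoeff_shift3]
    fin_cases a <;> fin_cases b <;> fin_cases c <;> simp
  · simp only [taoCoeff_shift1, taoCoeff_shift2, taoCoeff_shift3]
    (fin_cases a <;> fin_cases b <;> fin_cases c <;> simp); ring
  · simp only [taoCoeff_shift1, taoCoeff_shift2, taoCoeff_shift3]
    (fin_cases a <;> fin_cases b <;> fin_cases c <;> simp); ring

/-! ### From (4.10) with Table 1 to (6.3)–(6.7) -/

/-- `(1+ε₀)^{5(n-1)/2} (1+ε₀)^{5/2} = (1+ε₀)^{5n/2}`. [folklore] -/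
theorem rpow_scale_pred {ε₀ : ℝ} (hε₀ : -1 < ε₀) (n : ℝ) :
    (1 + ε₀) ^ ((5 : ℝ) * (n - 1) / 2) * (1 + ε₀) ^ ((5 : ℝ) / 2) =
      (1 + ε₀) ^ ((5 : ℝ) * n / 2) := by
  rw [← Real.rpow_add (by linarith)]
  congr 1
  ring

/-- `(1+ε₀)^{5n/2} (1+ε₀)^{5/2} = (1+ε₀)^{5(n+1)/2}`. [folklore] -/
theorem rpow_scale_succ {ε₀ : ℝ} (hε₀ : -1 < ε₀) (n : ℝ) :
    (1 + ε₀) ^ ((5 : ℝ) * n / 2) * (1 + ε₀) ^ ((5 : ℝ) / 2) =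
      (1 + ε₀) ^ ((5 : ℝ) * (n + 1) / 2) := by
  rw [← Real.rpow_add (by linarith)]
  congr 1
  ring

/-- **(4.10) with Table 1 is (6.3)** (main term of the equation of motion of `X_{1,n}`). [cite: Tao2016AveragedNS, §6.1 (6.3)] -/
theorem quadTerm_taoCoeff_zero {ε₀ : ℝ} (hε₀ : -1 < ε₀) (K ε : ℝ) (X : Fin 4 → ℤ → ℝ → ℝ)
    (n : ℤ) (t : ℝ) :
    quadTerm ε₀ (taoCoeff ε₀ K ε) X 0 n t = (1 + ε₀) ^ ((5 : ℝ) * n / 2) *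
      (-(ε ^ 2)⁻¹ * X 2 n t * X 3 n t - ε * X 0 n t * X 1 n t -
        ε ^ 2 * Real.exp (-K ^ 10) * X 0 n t * X 2 n t + K * X 3 (n - 1) t ^ 2) := by
  have hs := rpow_scale_pred hε₀ n
  simp [quadTerm, sum_shiftSet, Fin.sum_univ_four, taoCoeff_shift0, taoCoeff_shift1,
    taoCoeff_shift2, taoCoeff_shift3, tableZero]
  linear_combination (K * X 3 (n - 1) t ^ 2) * hs

/-- **(4.10) with Table 1 is (6.4)** (main term of the equation of motion of `X_{2,n}`). [cite: Tao2016AveragedNS, §6.1 (6.4)] -/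
theorem quadTerm_taoCoeff_one (ε₀ K ε : ℝ) (X : Fin 4 → ℤ → ℝ → ℝ) (n : ℤ) (t : ℝ) :
    quadTerm ε₀ (taoCoeff ε₀ K ε) X 1 n t = (1 + ε₀) ^ ((5 : ℝ) * n / 2) *
      (ε * X 0 n t ^ 2 - ε⁻¹ * K ^ 10 * X 2 n t ^ 2) := by
  simp [quadTerm, sum_shiftSet, Fin.sum_univ_four, taoCoeff_shift0, taoCoeff_shift1,
    taoCoeff_shift2, taoCoeff_shift3, tableZero]
  ring

/-- **(4.10) with Table 1 is (6.5)** (main term of the equation of motion of `X_{3,n}`). [cite: Tao2016AveragedNS, §6.1 (6.5)] -/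
theorem quadTerm_taoCoeff_two (ε₀ K ε : ℝ) (X : Fin 4 → ℤ → ℝ → ℝ) (n : ℤ) (t : ℝ) :
    quadTerm ε₀ (taoCoeff ε₀ K ε) X 2 n t = (1 + ε₀) ^ ((5 : ℝ) * n / 2) *
      (ε ^ 2 * Real.exp (-K ^ 10) * X 0 n t ^ 2 + ε⁻¹ * K ^ 10 * X 1 n t * X 2 n t) := by
  simp [quadTerm, sum_shiftSet, Fin.sum_univ_four, taoCoeff_shift0, taoCoeff_shift1,
    taoCoeff_shift2, taoCoeff_shift3, tableZero]
  ring

/-- **(4.10) with Table 1 is (6.6)** (main term of the equation of motion of `X_{4,n}`). [cite: Tao2016AveragedNS, §6.1 (6.6)] -/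
theorem quadTerm_taoCoeff_three (ε₀ K ε : ℝ) (X : Fin 4 → ℤ → ℝ → ℝ) (n : ℤ) (t : ℝ) :
    quadTerm ε₀ (taoCoeff ε₀ K ε) X 3 n t = (1 + ε₀) ^ ((5 : ℝ) * n / 2) *
      ((ε ^ 2)⁻¹ * X 2 n t * X 0 n t -
        (1 + ε₀) ^ ((5 : ℝ) / 2) * K * X 3 n t * X 0 (n + 1) t) := by
  simp [quadTerm, sum_shiftSet, Fin.sum_univ_four, taoCoeff_shift0, taoCoeff_shift1,
    taoCoeff_shift2, taoCoeff_shift3, tableZero]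
  ring

/-- **(4.11) with Table 1 sums to (6.7)**: by the cancellation (4.3) all same-scale cubic terms
cancel in `∑ᵢ (main term)ᵢ · X_{i,n}`, leaving the two scale-coupling fluxes
`(1+ε₀)^{5n/2} K X_{4,n-1}² X_{1,n} − (1+ε₀)^{5(n+1)/2} K X_{4,n}² X_{1,n+1}`. [cite: Tao2016AveragedNS, §6.1 (6.7)] -/
theorem sum_quadTerm_mul_taoCoeff {ε₀ : ℝ} (hε₀ : -1 < ε₀) (K ε : ℝ) (X : Fin 4 → ℤ → ℝ → ℝ)
    (n : ℤ) (t : ℝ) :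
    ∑ i, quadTerm ε₀ (taoCoeff ε₀ K ε) X i n t * X i n t =
      (1 + ε₀) ^ ((5 : ℝ) * n / 2) * K * X 3 (n - 1) t ^ 2 * X 0 n t -
        (1 + ε₀) ^ ((5 : ℝ) * (n + 1) / 2) * K * X 3 n t ^ 2 * X 0 (n + 1) t := by
  have h1 := rpow_scale_succ hε₀ n
  simp only [Fin.sum_univ_four, quadTerm_taoCoeff_zero hε₀, quadTerm_taoCoeff_one,
    quadTerm_taoCoeff_two, quadTerm_taoCoeff_three]
  linear_combination (-(K * X 3 n t ^ 2 * X 0 (n + 1) t)) * h1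

/-- `√(E₁+E₂+E₃+E₄) ≤ √E₁ + √E₂ + √E₃ + √E₄` for non-negative reals. [folklore] -/
theorem sqrt_sum_le_sum_sqrt (E : Fin 4 → ℝ) (hE : ∀ i, 0 ≤ E i) :
    Real.sqrt (∑ i, E i) ≤ ∑ i, Real.sqrt (E i) := by
  have hs : ∀ i, 0 ≤ Real.sqrt (E i) := fun i => Real.sqrt_nonneg _
  have hsq : ∀ i, Real.sqrt (E i) ^ 2 = E i := fun i => Real.sq_sqrt (hE i)
  rw [← Real.sqrt_sq (Finset.sum_nonneg fun i _ => hs i)]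
  apply Real.sqrt_le_sqrt
  simp only [Fin.sum_univ_four]
  nlinarith [mul_nonneg (hs 0) (hs 1), mul_nonneg (hs 0) (hs 2), mul_nonneg (hs 0) (hs 3),
    mul_nonneg (hs 1) (hs 2), mul_nonneg (hs 1) (hs 3), mul_nonneg (hs 2) (hs 3),
    hsq 0, hsq 1, hsq 2, hsq 3]

/-! ### Theorem 6.2 implies Theorem 4.2 -/

/-- **Lemma 4.1's conclusions for Table 1 give the system of §6.1** (Tao 2016, p. 31: the
equations (6.1)–(6.10) "by Lemma 4.1 (i)–(v)"): if `X_{i,n}, E_{i,n}` obey the conclusions of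
Lemma 4.1 with `m = 4`, datum mode `1` (index `0`), `α =` Table 1 and implied constants
`K₁ ≥ 0`, `K₂`, then `X_{i,n}` and the combined energies `E_n = ∑ᵢ E_{i,n}` obey the system of
§6.1 with the same implied constants. [cite: Tao2016AveragedNS, §6.1] -/
theorem CascadeODESolution.toTaoODESystem {ε₀ K ε K₁ K₂ : ℝ} (hε₀ : 0 < ε₀) (hK₁ : 0 ≤ K₁)
    {n₀ : ℤ} {X E : Fin 4 → ℤ → ℝ → ℝ}
    (h : CascadeODESolution ε₀ 0 (taoCoeff ε₀ K ε) K₁ K₂ n₀ X E) :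
    TaoODESystem ε₀ K ε K₁ K₂ n₀ X (fun n t => ∑ i, E i n t) where
  contDiffOn_X := h.contDiffOn_X
  contDiffOn_E n := by
    have hE := fun i => h.contDiffOn_E i n
    simp only [Fin.sum_univ_four]
    exact (((hE 0).add (hE 1)).add (hE 2)).add (hE 3)
  nonneg_E n t ht := Finset.sum_nonneg fun i _ => h.nonneg_E i n t ht
  apriori_X := h.apriori_X
  apriori_E T hT := by
    obtain ⟨M, hM⟩ := h.apriori_E T hT
    refine ⟨4 * M, fun t ht n => ?_⟩
    have hpos : 0 < 1 + ε₀ := by linarith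
    have hw : 0 ≤ 1 + (1 + ε₀) ^ ((10 : ℝ) * n) := by positivity
    calc (1 + (1 + ε₀) ^ ((10 : ℝ) * n)) * Real.sqrt (∑ i, E i n t)
        ≤ (1 + (1 + ε₀) ^ ((10 : ℝ) * n)) * ∑ i, Real.sqrt (E i n t) :=
          mul_le_mul_of_nonneg_left (sqrt_sum_le_sum_sqrt _ fun i => h.nonneg_E i n t ht.1) hw
      _ = ∑ i, (1 + (1 + ε₀) ^ ((10 : ℝ) * n)) * Real.sqrt (E i n t) := Finset.mul_sum _ _ _
      _ ≤ ∑ _i : Fin 4, M := Finset.sum_le_sum fun i _ => hM t ht i n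
      _ = 4 * M := by simp
  eq1 n t ht := by
    rw [← quadTerm_taoCoeff_zero (by linarith) K ε X n t]
    calc _ ≤ K₁ * (1 + ε₀) ^ ((2 : ℝ) * n) * Real.sqrt (E 0 n t) := h.motion 0 n t ht
      _ ≤ _ := by
        gcongr
        exact Finset.single_le_sum (fun j _ => h.nonneg_E j n t ht) (Finset.mem_univ 0)
  eq2 n t ht := by
    rw [← quadTerm_taoCoeff_one ε₀ K ε X n t]
    calc _ ≤ K₁ * (1 + ε₀) ^ ((2 : ℝ) * n) * Real.sqrt (E 1 n t) := h.motion 1 n t ht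
      _ ≤ _ := by
        gcongr
        exact Finset.single_le_sum (fun j _ => h.nonneg_E j n t ht) (Finset.mem_univ 1)
  eq3 n t ht := by
    rw [← quadTerm_taoCoeff_two ε₀ K ε X n t]
    calc _ ≤ K₁ * (1 + ε₀) ^ ((2 : ℝ) * n) * Real.sqrt (E 2 n t) := h.motion 2 n t ht
      _ ≤ _ := by
        gcongr
        exact Finset.single_le_sum (fun j _ => h.nonneg_E j n t ht) (Finset.mem_univ 2)
  eq4 n t ht := by
    rw [← quadTerm_taoCoeff_three ε₀ K ε X n t]
    calc _ ≤ K₁ * (1 + ε₀) ^ ((2 : ℝ) * n) * Real.sqrt (E 3 n t) := h.motion 3 n t ht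
      _ ≤ _ := by
        gcongr
        exact Finset.single_le_sum (fun j _ => h.nonneg_E j n t ht) (Finset.mem_univ 3)
  energy n t ht := by
    have hd : ∀ i, HasDerivWithinAt (E i n) (derivWithin (E i n) (Ici 0) t) (Ici 0) t :=
      fun i => (((h.contDiffOn_E i n).differentiableOn one_ne_zero) t ht).hasDerivWithinAt
    have hsum : HasDerivWithinAt (fun s => ∑ i, E i n s)
        (∑ i, derivWithin (E i n) (Ici 0) t) (Ici 0) t :=
      HasDerivWithinAt.fun_sum fun i _ => hd i
    rw [hsum.derivWithin (uniqueDiffOn_Ici 0 t ht)]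
    calc ∑ i, derivWithin (E i n) (Ici 0) t
        ≤ ∑ i, quadTerm ε₀ (taoCoeff ε₀ K ε) X i n t * X i n t :=
          Finset.sum_le_sum fun i _ => h.energy i n t ht
      _ = _ := sum_quadTerm_mul_taoCoeff (by linarith) K ε X n t
  init_E n := by
    by_cases hn : n = n₀ <;> simp [hn, h.init_E, h.init_X]
  init_X := h.init_X
  defect_lower n t ht := by
    rw [Finset.mul_sum]
    exact Finset.sum_le_sum fun i _ => h.defect_lower i n t ht
  defect_upper n t ht := by
    have hI : ∀ i, IntervalIntegrable (E i n) volume 0 t := fun i =>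
      ((h.contDiffOn_E i n).continuousOn.mono
        (by rw [Set.uIcc_of_le ht]; exact Set.Icc_subset_Ici_self)).intervalIntegrable
    calc ∑ i, E i n t
        ≤ ∑ i, ((1 / 2) * X i n t ^ 2 +
            K₂ * (1 + ε₀) ^ ((2 : ℝ) * n) * ∫ s in (0 : ℝ)..t, E i n s) :=
          Finset.sum_le_sum fun i _ => h.defect_upper i n t ht
      _ = (1 / 2) * ∑ i, X i n t ^ 2 +
            K₂ * (1 + ε₀) ^ ((2 : ℝ) * n) * ∫ s in (0 : ℝ)..t, ∑ i, E i n s := by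
          rw [intervalIntegral.integral_finsetSum fun i _ => hI i, Finset.sum_add_distrib,
            Finset.mul_sum, Finset.mul_sum]
  noLow_E n t hn ht := Finset.sum_eq_zero fun i _ => h.noLow_E i n t hn ht
  noLow_X := h.noLow_X

/-- **Theorem 6.2 implies Theorem 4.2** (Tao 2016, p. 31: "To prove Theorem 4.2, it thus
suffices to show Theorem 6.2"): given `0 < ε₀ < 1`, take `K = max K₀ 1` and `ε = e₀` from
Theorem 6.2, `m = 4`, datum mode `i₀ = 0` and `α =` Table 1 (`taoCoeff`), which obeys (4.2) and
(4.3); for implied constants `K₁, K₂ ≥ 0` any family obeying the conclusions of Lemma 4.1 yields,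
with `E_n = ∑ᵢ E_{i,n}`, a solution of the system of §6.1 with the same constants
(`CascadeODESolution.toTaoODESystem`), which Theorem 6.2 excludes for `n₀` large. [cite: Tao2016AveragedNS, §6.1] -/
theorem odeBlowup_of_noGlobalODESolution (h62 : noGlobalODESolution) : odeBlowup := by
  intro ε₀ hε₀ hε₀1
  obtain ⟨K₀, hK₀⟩ := h62 ε₀ hε₀ hε₀1
  obtain ⟨e₀, he₀, he⟩ := hK₀ (max K₀ 1) (le_max_left _ _) (lt_max_of_lt_right one_pos)
  refine ⟨4, 0, taoCoeff ε₀ (max K₀ 1) e₀, taoCoeff_symmetric _ _ _, taoCoeff_cancelling _ _ _,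
    fun K₁ K₂ hK₁ hK₂ => ?_⟩
  obtain ⟨N₀, hN₀⟩ := he e₀ he₀ le_rfl K₁ K₂ hK₁ hK₂
  exact ⟨N₀, fun n₀ hn₀ ⟨X, E, hXE⟩ =>
    hN₀ n₀ hn₀ ⟨X, fun n t => ∑ i, E i n t, hXE.toTaoODESystem hε₀ hK₁⟩⟩

end TaoCascade

end Literature.Analysis.FluidPDE
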